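import Summits.CriticalPhenomena.Ising3DConformalLimit.Theorems.PerfectScreeningGaussianLimitNotScreenedDoubleTermKernelSumMass
import Summits.CriticalPhenomena.Ising3DConformalLimit.Theorems.PerfectScreeningGaussianLimitNotScreenedDoubleTermKernelSumFar
import Mathlib.MeasureTheory.Constructions.HaarToSphere
import Mathlib.Analysis.SpecialFunctions.Integrability.Basic
import HarnessLib

/-!
# Crux `GaussianLimitNotScreened` (stmt-CriticalPhenomena-13886), line `single-layer-linear-regression`:
# stub B2b `stub_doubleTermKernelSum` — the singular-kernel layer Riemann sum

THEOREM-ONLY. Registered stub `stub_doubleTermKernelSum` of the checked skeleton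
`Cruxes/GaussianLimitNotScreened/Lines/single_layer_linear_regression.lean`. Under the crux hypotheses
(a non-degenerate, Möbius-covariant pointwise scaling limit `(ρ, Δ, S)` of `criticalCorr 3`; no
Gaussianity is used):

* (mass) `∀ R ∃ C, Σ_{z ∈ layerBox R n} n⁻² ⟨σ₀σ_{(0,z)}⟩ ≤ C ⟨σ₀σ_{2n e₀}⟩` eventually
  (landed helper `doubleTermKernelSum_mass`, file `…DoubleTermKernelSumMass.lean`);
* (limit) for every continuous `Ψ` vanishing outside the ball of radius `R`,
  `Σ_{z ∈ layerBox R n} n⁻² Ψ(z/n) ⟨σ₀σ_{(0,z)}⟩ / ⟨σ₀σ_{2n e₀}⟩ → 4^Δ ∫ Ψ(v) ‖v‖^{−2Δ} dv`.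

Proof of (limit): the window `Δ ∈ [1/2, 3/4]` (`delta_mem_Icc_of_covariantLimit`) gives `0 < 2Δ < 2`,
so `‖v‖^{−2Δ} ∈ L¹_loc(ℝ²)` (polar coordinates, `integrableOn_fun_norm_addHaar`) and `Ψ‖·‖^{−2Δ} ∈ L¹`.
With the continuous cutoffs `χ_p = min 1 (max 0 (2^{p+1}‖·‖ − 1))` (`= 0` on `‖v‖ ≤ 2^{−p−1}`, `= 1` on
`2^p‖v‖ ≥ 1`): FAR from the origin the landed helper `doubleTermKernelSum_far`
(file `…DoubleTermKernelSumFar.lean`, B1's mechanism on the punctured layer) gives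
`Σ n⁻² (Ψχ_p)(z/n) ⟨σ₀σ_{(0,z)}⟩ / ⟨σ₀σ_{2n e₀}⟩ → 4^Δ ∫ Ψ χ_p ‖v‖^{−2Δ}`, and
`∫ Ψ χ_p ‖v‖^{−2Δ} → ∫ Ψ ‖v‖^{−2Δ}` as `p → ∞` by dominated convergence; NEAR the origin
(`2^p‖z/n‖ < 1 ⇒ ‖z‖_∞ < n2^{−p} < M`) the lattice block is
`≤ ‖Ψ‖_∞ (1 + Σ_{0<‖z‖_∞≤M} ⟨σ₀σ_{(0,z)}⟩)/(n² ⟨σ₀σ_{2n e₀}⟩) ≤ ‖Ψ‖_∞/(n² ⟨σ₀σ_{2n e₀}⟩) + ‖Ψ‖_∞ C (θ/4)^p`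
by the landed `stub_doubleTermLimit_nearDiagonal` (`θ < 4`) and `n² ⟨σ₀σ_{2n e₀}⟩ → ∞`. Given `η > 0`
choose `p` (both `p`-errors `< η/4`), then `n`.
-/

noncomputable section

namespace Summit.CriticalPhenomena.Ising3DConformalLimit.Cruxes.GaussianLimitNotScreened.SingleLayerLinearRegression

open MeasureTheory Filter Topology
open Literature.Probability.LatticeModels
open Summit.CriticalPhenomena.Ising3DConformalLimit.MoebiusLimitExistsNegative (delta_mem_Icc_of_covariantLimit)

/-! ### The continuum side: `‖v‖^{-2Δ} ∈ L¹_loc(ℝ²)` and the cutoff removal -/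

/-- A continuous profile vanishing outside the ball of radius `R` is bounded. [folklore] -/
theorem doubleTermKernelSum_bound {Ψ : E2 → ℝ} {R : ℕ} (hΨc : Continuous Ψ)
    (hΨs : ∀ v : E2, (R : ℝ) ≤ ‖v‖ → Ψ v = 0) : ∃ B : ℝ, 0 ≤ B ∧ ∀ v, |Ψ v| ≤ B := by
  obtain ⟨C, hC⟩ :=
    (isCompact_closedBall (0 : E2) R).exists_bound_of_continuousOn hΨc.continuousOn
  refine ⟨max C 0, le_max_right _ _, fun v => ?_⟩
  by_cases hv : (R : ℝ) ≤ ‖v‖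
  · rw [hΨs v hv, abs_zero]; exact le_max_right _ _
  · have := hC v (mem_closedBall_zero_iff.2 (not_le.1 hv).le)
    rw [Real.norm_eq_abs] at this
    exact this.trans (le_max_left _ _)

/-- `‖v‖^{-2Δ}` is integrable on the balls of `ℝ²` for `Δ < 1` (polar coordinates:
`r ↦ r · r^{-2Δ} = r^{1-2Δ}` is integrable at `0⁺` iff `1 - 2Δ > -1`). [folklore] -/
theorem doubleTermKernelSum_integrableOn_ball {Δ : ℝ} (hΔ1 : Δ < 1) {r : ℝ} (hr : 0 < r) :
    IntegrableOn (fun v : E2 => ‖v‖ ^ (-(2 * Δ))) (Metric.ball 0 r) := by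
  refine (integrableOn_fun_norm_addHaar (volume : Measure E2) (f := fun y : ℝ => y ^ (-(2 * Δ)))
    (r := r)).2 ?_
  rw [finrank_euclideanSpace_fin]
  have h2 : IntegrableOn (fun y : ℝ => y ^ (1 - 2 * Δ)) (Set.Ioo 0 r) :=
    (intervalIntegral.integrableOn_Ioo_rpow_iff hr).2 (by linarith)
  refine (integrableOn_congr_fun (fun y hy => ?_) measurableSet_Ioo).2 h2
  simp only [smul_eq_mul, show (2:ℕ) - 1 = 1 from rfl, pow_one]
  rw [show (1:ℝ) - 2 * Δ = 1 + (-(2 * Δ)) by ring, Real.rpow_add hy.1, Real.rpow_one]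

/-- For `Δ < 1` and a continuous profile `Ψ` vanishing outside the ball of radius `R`,
`Ψ(v)‖v‖^{-2Δ}` is integrable on `ℝ²`. [folklore] -/
theorem doubleTermKernelSum_integrable {Δ : ℝ} (hΔ1 : Δ < 1) {Ψ : E2 → ℝ} {R : ℕ}
    (hΨc : Continuous Ψ) (hΨs : ∀ v : E2, (R : ℝ) ≤ ‖v‖ → Ψ v = 0) :
    Integrable (fun v : E2 => Ψ v * ‖v‖ ^ (-(2 * Δ))) := by
  obtain ⟨B, -, hB⟩ := doubleTermKernelSum_bound hΨc hΨs
  have hsupp : Function.support (fun v : E2 => Ψ v * ‖v‖ ^ (-(2 * Δ))) ⊆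
      Metric.ball 0 ((R : ℝ) + 1) := by
    intro v hv
    rw [Function.mem_support] at hv
    rw [mem_ball_zero_iff]
    by_contra h
    exact hv (by rw [hΨs v (by linarith [not_lt.1 h]), zero_mul])
  rw [← integrableOn_iff_integrable_of_support_subset hsupp]
  exact Integrable.bdd_mul (doubleTermKernelSum_integrableOn_ball hΔ1 (by positivity))
    hΨc.aestronglyMeasurable (Eventually.of_forall fun v => by rw [Real.norm_eq_abs]; exact hB v)

/-- Removing a continuum cutoff at the origin: if `0 ≤ χ_p ≤ 1` and `χ_p = 1` on `{2^p ‖v‖ ≥ 1}`,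
then `∫ Ψ χ_p ‖v‖^{-2Δ} → ∫ Ψ ‖v‖^{-2Δ}` as `p → ∞` (dominated convergence, dominated by
`|Ψ| ‖v‖^{-2Δ} ∈ L¹(ℝ²)` since `2Δ < 2`). [folklore] -/
theorem doubleTermKernelSum_cutoff_tendsto {Δ : ℝ} (hΔ0 : 0 < Δ) (hΔ1 : Δ < 1) {Ψ : E2 → ℝ}
    {R : ℕ} (hΨc : Continuous Ψ) (hΨs : ∀ v : E2, (R : ℝ) ≤ ‖v‖ → Ψ v = 0)
    (χ : ℕ → E2 → ℝ) (hχc : ∀ p, Continuous (χ p)) (hχ01 : ∀ p v, 0 ≤ χ p v ∧ χ p v ≤ 1)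
    (hχ1 : ∀ (p : ℕ) (v : E2), 1 ≤ 2 ^ p * ‖v‖ → χ p v = 1) :
    Tendsto (fun p : ℕ => ∫ v : E2, Ψ v * χ p v * ‖v‖ ^ (-(2 * Δ))) atTop
      (𝓝 (∫ v : E2, Ψ v * ‖v‖ ^ (-(2 * Δ)))) := by
  have hI := doubleTermKernelSum_integrable hΔ1 hΨc hΨs
  have hmeas : ∀ p, AEStronglyMeasurable (fun v : E2 => Ψ v * χ p v * ‖v‖ ^ (-(2 * Δ))) volume :=
    fun p => ((hΨc.mul (hχc p)).aestronglyMeasurable).mul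
      (measurable_norm.pow_const _).aestronglyMeasurable
  refine tendsto_integral_of_dominated_convergence (fun v => ‖Ψ v * ‖v‖ ^ (-(2 * Δ))‖) hmeas
    hI.norm ?_ ?_
  · intro p
    refine Eventually.of_forall fun v => ?_
    have h0 : 0 ≤ ‖v‖ ^ (-(2 * Δ)) := Real.rpow_nonneg (norm_nonneg _) _
    obtain ⟨hχ0', hχ1'⟩ := hχ01 p v
    rw [Real.norm_eq_abs, Real.norm_eq_abs, abs_mul, abs_mul, abs_mul, abs_of_nonneg h0,
      abs_of_nonneg hχ0']
    calc |Ψ v| * χ p v * ‖v‖ ^ (-(2 * Δ)) ≤ |Ψ v| * 1 * ‖v‖ ^ (-(2 * Δ)) := by gcongr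
      _ = |Ψ v| * ‖v‖ ^ (-(2 * Δ)) := by rw [mul_one]
  · refine Eventually.of_forall fun v => ?_
    by_cases hv : v = 0
    · subst hv
      have h0 : (‖(0:E2)‖ : ℝ) ^ (-(2 * Δ)) = 0 := by
        rw [norm_zero, Real.zero_rpow (by linarith : -(2 * Δ) ≠ 0)]
      simp only [h0, mul_zero]
      exact tendsto_const_nhds
    · have hvpos : 0 < ‖v‖ := norm_pos_iff.2 hv
      have hev : ∀ᶠ p : ℕ in atTop, 1 ≤ (2:ℝ) ^ p * ‖v‖ :=
        ((tendsto_pow_atTop_atTop_of_one_lt one_lt_two).atTop_mul_const hvpos).eventually_ge_atTop 1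
      refine (tendsto_const_nhds (x := Ψ v * ‖v‖ ^ (-(2 * Δ)))).congr' ?_
      filter_upwards [hev] with p hp
      rw [hχ1 p v hp, mul_one]

/-! ### The continuum cutoffs -/

/-- Continuum cutoffs at the origin: `χ_p(v) = min 1 (max 0 (2^{p+1}‖v‖ − 1))` is continuous,
`[0,1]`-valued, vanishes on `‖v‖ ≤ 2^{-(p+1)}` and equals `1` on `2^p ‖v‖ ≥ 1`. [folklore] -/
theorem doubleTermKernelSum_cutoff :
    ∃ χ : ℕ → E2 → ℝ, (∀ p, Continuous (χ p)) ∧ (∀ p v, 0 ≤ χ p v ∧ χ p v ≤ 1) ∧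
      (∀ (p : ℕ) (v : E2), ‖v‖ ≤ (2 * 2 ^ p)⁻¹ → χ p v = 0) ∧
      (∀ (p : ℕ) (v : E2), 1 ≤ 2 ^ p * ‖v‖ → χ p v = 1) := by
  refine ⟨fun p v => min 1 (max 0 (2 * 2 ^ p * ‖v‖ - 1)), fun p => ?_,
    fun p v => ⟨le_min zero_le_one (le_max_left _ _), min_le_left _ _⟩, fun p v hv => ?_,
    fun p v hv => ?_⟩
  · exact continuous_const.min (continuous_const.max
      ((continuous_const.mul continuous_norm).sub continuous_const))
  · have h2 : (0:ℝ) < 2 * 2 ^ p := by positivity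
    have h3 : 2 * 2 ^ p * ‖v‖ ≤ 1 := by
      calc 2 * 2 ^ p * ‖v‖ ≤ 2 * 2 ^ p * (2 * 2 ^ p)⁻¹ := by gcongr
        _ = 1 := mul_inv_cancel₀ h2.ne'
    show min (1:ℝ) (max 0 (2 * 2 ^ p * ‖v‖ - 1)) = 0
    rw [max_eq_left (by linarith), min_eq_right zero_le_one]
  · show min (1:ℝ) (max 0 (2 * 2 ^ p * ‖v‖ - 1)) = 1
    exact min_eq_left (le_trans (by linarith) (le_max_right _ _))

/-! ### The stub -/

/-- **Stub B2b** (`stub_doubleTermKernelSum`) — SINGULAR-KERNEL LAYER RIEMANN SUM. Under the crux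
hypotheses (no Gaussianity): (mass) for every `R` there is `C` with
`Σ_{z ∈ layerBox R n} n⁻² ⟨σ₀σ_{(0,z)}⟩ ≤ C ⟨σ₀σ_{2n e₀}⟩` for all large `n`; (limit) for every continuous
`Ψ` vanishing outside the ball of radius `R`,
`Σ_{z ∈ layerBox R n} n⁻² Ψ(z/n) ⟨σ₀σ_{(0,z)}⟩ / ⟨σ₀σ_{2n e₀}⟩ → 4^Δ ∫ Ψ(v) ‖v‖^{−2Δ} dv`.
Proof: the window `Δ ∈ [1/2, 3/4]` gives `0 < 2Δ < 2`; with the cutoffs `χ_p`, FAR from the origin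
`doubleTermKernelSum_far` (B1's mechanism on the punctured layer) gives the limit
`4^Δ ∫ Ψ χ_p ‖v‖^{−2Δ}`, which tends to `4^Δ ∫ Ψ ‖v‖^{−2Δ}` as `p → ∞` (dominated convergence,
`‖v‖^{−2Δ} ∈ L¹_loc(ℝ²)`); NEAR the origin (`2^p ‖z/n‖ < 1`, so `‖z‖_∞ < n 2^{-p} < M`) the lattice
block is `≤ ‖Ψ‖_∞ (1 + Σ_{0<‖z‖_∞≤M} ⟨σ₀σ_{(0,z)}⟩)/(n² ⟨σ₀σ_{2n e₀}⟩) ≤ ‖Ψ‖_∞ (o(1) + C (θ/4)^p)`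
by the landed `stub_doubleTermLimit_nearDiagonal`; choose `p`, then `n`. [folklore] -/
theorem stub_doubleTermKernelSum :
    ∀ (ρ : ℝ → ℝ) (Δ : ℝ) (S : CorrFamily 3), (∀ δ ∈ Set.Ioc (0:ℝ) 1, 0 < ρ δ) →
      HasPointwiseScalingLimit (criticalCorr 3) ρ S → IsNondegenerateTwoPoint S →
      IsMoebiusCovariant Δ S →
      (∀ R : ℕ, ∃ C : ℝ, ∀ᶠ n : ℕ in atTop,
          ∑ z ∈ layerBox R n, criticalTwoPoint 3 (Fin.cons 0 z) / (n : ℝ) ^ 2 ≤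
            C * criticalTwoPoint 3 (Pi.single 0 ((2 * n : ℕ) : ℤ))) ∧
      ∀ (Ψ : E2 → ℝ) (R : ℕ), Continuous Ψ → (∀ v : E2, (R : ℝ) ≤ ‖v‖ → Ψ v = 0) →
        Tendsto (fun n : ℕ =>
            (∑ z ∈ layerBox R n, Ψ ((n : ℝ)⁻¹ • planeVec z) / (n : ℝ) ^ 2 *
                criticalTwoPoint 3 (Fin.cons 0 z)) /
              criticalTwoPoint 3 (Pi.single 0 ((2 * n : ℕ) : ℤ)))
          atTop (𝓝 ((4:ℝ) ^ Δ * ∫ v : E2, Ψ v * ‖v‖ ^ (-(2 * Δ)))) := by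
  intro ρ Δ S hρ hlim hnd hMo
  refine ⟨doubleTermKernelSum_mass ρ Δ S hρ hlim hnd hMo, ?_⟩
  intro Ψ R hΨc hΨs
  classical
  have hrot : IsRotationInvariant S := hMo.isEuclideanInvariant.2
  have hsc : IsScaleCovariant Δ S := hMo.isScaleCovariant
  have hwin := delta_mem_Icc_of_covariantLimit hρ hlim hnd hrot hsc
  have hΔ1 : Δ < 1 := lt_of_le_of_lt hwin.2 (by norm_num)
  have hΔ0 : 0 < Δ := lt_of_lt_of_le (by norm_num) hwin.1
  obtain ⟨B, hB0, hB⟩ := doubleTermKernelSum_bound hΨc hΨs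
  obtain ⟨hdiv, C, θ, hC, hθ, hθ4, hnear⟩ :=
    stub_doubleTermLimit_nearDiagonal ρ Δ S hlim hnd hsc hΔ1
  obtain ⟨χ, hχc, hχ01, hχ0, hχ1⟩ := doubleTermKernelSum_cutoff
  have hcont := (doubleTermKernelSum_cutoff_tendsto hΔ0 hΔ1 hΨc hΨs χ hχc hχ01 hχ1).const_mul
    ((4:ℝ) ^ Δ)
  rw [Metric.tendsto_atTop]
  intro η hη
  -- choose the dyadic depth `p` of the cutoff
  have hp1 : ∀ᶠ p : ℕ in atTop, B * C * (θ / 4) ^ p < η / 4 := by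
    have h1 : θ / 4 < 1 := by rw [div_lt_one (by norm_num : (0:ℝ) < 4)]; exact hθ4
    have := (tendsto_pow_atTop_nhds_zero_of_lt_one (by positivity) h1).const_mul (B * C)
    rw [mul_zero] at this
    exact this.eventually (gt_mem_nhds (by positivity))
  have hp2 : ∀ᶠ p : ℕ in atTop, dist ((4:ℝ) ^ Δ * ∫ v, Ψ v * χ p v * ‖v‖ ^ (-(2 * Δ)))
      ((4:ℝ) ^ Δ * ∫ v, Ψ v * ‖v‖ ^ (-(2 * Δ))) < η / 4 :=
    Metric.tendsto_nhds.1 hcont _ (by positivity)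
  obtain ⟨p, hp1', hp2'⟩ := (hp1.and hp2).exists
  -- the far part with `Φ = Ψ χ_p`, the near-diagonal input at depth `p`, and `n² G(2n e₀) → ∞`
  have hfar := doubleTermKernelSum_far ρ Δ S hρ hlim hnd hMo (fun v => Ψ v * χ p v) R (2 * 2 ^ p)⁻¹
    (hΨc.mul (hχc p)) (fun v hv => by simp [hΨs v hv]) (by positivity)
    (fun v hv => by simp [hχ0 p v hv])
  obtain ⟨N₁, hN₁⟩ := Metric.tendsto_atTop.1 hfar (η / 4) (by positivity)
  obtain ⟨N₀, hN₀⟩ := hnear p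
  obtain ⟨N₂, hN₂⟩ := eventually_atTop.1
    ((hdiv.const_mul_atTop (by positivity : (0:ℝ) < η / 4)).eventually_gt_atTop B)
  refine ⟨max (max N₀ N₁) (max N₂ 1), fun n hn => ?_⟩
  have hnN₀ : N₀ ≤ n := (le_max_left _ _).trans ((le_max_left _ _).trans hn)
  have hnN₁ : N₁ ≤ n := (le_max_right _ _).trans ((le_max_left _ _).trans hn)
  have hnN₂ : N₂ ≤ n := (le_max_left _ _).trans ((le_max_right _ _).trans hn)
  have hn1 : 1 ≤ n := (le_max_right _ _).trans ((le_max_right _ _).trans hn)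
  have hn' : (0:ℝ) < n := by exact_mod_cast hn1
  have h1 := hN₁ n hnN₁
  have h4 := hN₂ n hnN₂
  obtain ⟨M, hM1, -, hsumM⟩ := hN₀ n hnN₀
  have hgpos : 0 < criticalTwoPoint 3 (Pi.single (0 : Fin 3) ((2 * n : ℕ) : ℤ)) :=
    criticalTwoPoint_axis_pos (2 * n)
  set g : ℝ := criticalTwoPoint 3 (Pi.single (0 : Fin 3) ((2 * n : ℕ) : ℤ)) with hgdef
  have hg0 : g ≠ 0 := hgpos.ne'
  have hn0 : (n:ℝ) ≠ 0 := hn'.ne'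
  -- NEAR: the lattice points with `2^p ‖z/n‖ < 1` lie in the sup-norm box of radius `M`
  have hmem : ∀ z : Fin 2 → ℤ, 2 ^ p * ‖(n : ℝ)⁻¹ • planeVec z‖ < 1 → z ∈ box 2 M := by
    intro z hz
    rw [mem_box]
    intro i
    have hvi : |(z i : ℝ)| ≤ ‖planeVec z‖ := by
      have := PiLp.norm_apply_le (planeVec z) i
      rwa [Real.norm_eq_abs] at this
    have hnorm : ‖(n : ℝ)⁻¹ • planeVec z‖ = (n:ℝ)⁻¹ * ‖planeVec z‖ := by
      rw [norm_smul, Real.norm_eq_abs, abs_of_pos (inv_pos.2 hn')]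
    have h2p : (0:ℝ) < 2 ^ p := by positivity
    have hM1' : (2 * n : ℝ) < M * 2 ^ p := by exact_mod_cast hM1
    have h3 : 2 ^ p * ‖planeVec z‖ < n := by
      have : 2 ^ p * ‖planeVec z‖ / n < 1 := by
        calc 2 ^ p * ‖planeVec z‖ / n = 2 ^ p * ((n:ℝ)⁻¹ * ‖planeVec z‖) := by ring
          _ < 1 := by rw [← hnorm]; exact hz
      rwa [div_lt_one hn'] at this
    have h5 : (2:ℝ) ^ p * |(z i : ℝ)| < 2 ^ p * M := by
      calc (2:ℝ) ^ p * |(z i : ℝ)| ≤ 2 ^ p * ‖planeVec z‖ := by gcongr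
        _ < n := h3
        _ ≤ 2 ^ p * M := by linarith
    have hlt : |(z i : ℝ)| < M := lt_of_mul_lt_mul_left h5 h2p.le
    obtain ⟨h6, h7⟩ := abs_lt.1 hlt
    have h8 : -(M:ℤ) < z i := by exact_mod_cast h6
    have h9 : z i < (M:ℤ) := by exact_mod_cast h7
    exact ⟨h8.le, h9.le⟩
  -- NEAR: the lattice block
  have hnear_bd : |∑ z ∈ layerBox R n, Ψ ((n : ℝ)⁻¹ • planeVec z) *
      (1 - χ p ((n : ℝ)⁻¹ • planeVec z)) / (n:ℝ) ^ 2 * criticalTwoPoint 3 (Fin.cons 0 z)| ≤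
      B / (n:ℝ) ^ 2 * (1 + C * (θ / 4) ^ p * (n:ℝ) ^ 2 * g) := by
    calc |∑ z ∈ layerBox R n, Ψ ((n : ℝ)⁻¹ • planeVec z) *
          (1 - χ p ((n : ℝ)⁻¹ • planeVec z)) / (n:ℝ) ^ 2 * criticalTwoPoint 3 (Fin.cons 0 z)|
        ≤ ∑ z ∈ layerBox R n, |Ψ ((n : ℝ)⁻¹ • planeVec z) *
          (1 - χ p ((n : ℝ)⁻¹ • planeVec z)) / (n:ℝ) ^ 2 * criticalTwoPoint 3 (Fin.cons 0 z)| :=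
          Finset.abs_sum_le_sum_abs _ _
      _ ≤ ∑ z ∈ layerBox R n, (if 2 ^ p * ‖(n : ℝ)⁻¹ • planeVec z‖ < 1 then
            B / (n:ℝ) ^ 2 * criticalTwoPoint 3 (Fin.cons 0 z) else 0) := by
          refine Finset.sum_le_sum fun z _ => ?_
          have hGz : 0 ≤ criticalTwoPoint 3 (Fin.cons 0 z) := criticalTwoPoint_nonneg' _
          split_ifs with hz
          · obtain ⟨hχa, hχb⟩ := hχ01 p ((n : ℝ)⁻¹ • planeVec z)
            have hΨ1 : |Ψ ((n : ℝ)⁻¹ • planeVec z) * (1 - χ p ((n : ℝ)⁻¹ • planeVec z))| ≤ B := by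
              rw [abs_mul, abs_of_nonneg (by linarith : 0 ≤ 1 - χ p ((n : ℝ)⁻¹ • planeVec z))]
              calc |Ψ ((n : ℝ)⁻¹ • planeVec z)| * (1 - χ p ((n : ℝ)⁻¹ • planeVec z)) ≤ B * 1 :=
                    mul_le_mul (hB _) (by linarith) (by linarith) hB0
                _ = B := mul_one B
            rw [abs_mul, abs_div, abs_of_nonneg hGz, abs_of_pos (by positivity : (0:ℝ) < (n:ℝ) ^ 2)]
            gcongr
          · rw [hχ1 p _ (not_lt.1 hz)]
            simp
      _ = B / (n:ℝ) ^ 2 * ∑ z ∈ (layerBox R n).filter (fun z => 2 ^ p * ‖(n : ℝ)⁻¹ • planeVec z‖ < 1),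
            criticalTwoPoint 3 (Fin.cons 0 z) := by
          rw [Finset.sum_filter, Finset.mul_sum]
          refine Finset.sum_congr rfl fun z _ => ?_
          split_ifs <;> simp
      _ ≤ B / (n:ℝ) ^ 2 * ∑ z ∈ box 2 M, criticalTwoPoint 3 (Fin.cons 0 z) := by
          refine mul_le_mul_of_nonneg_left
            (Finset.sum_le_sum_of_subset_of_nonneg ?_ fun z _ _ => criticalTwoPoint_nonneg' _)
            (by positivity)
          intro z hz
          rw [Finset.mem_filter] at hz
          exact hmem z hz.2
      _ = B / (n:ℝ) ^ 2 * (1 + ∑ z ∈ (box 2 M).erase 0, criticalTwoPoint 3 (Fin.cons 0 z)) := by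
          rw [doubleTermKernelSum_sum_box]
      _ ≤ B / (n:ℝ) ^ 2 * (1 + C * (θ / 4) ^ p * (n:ℝ) ^ 2 * g) := by gcongr
  have i1 : B / ((n:ℝ) ^ 2 * g) < η / 4 := by rw [div_lt_iff₀ (by positivity)]; exact h4
  have h3 : |(∑ z ∈ layerBox R n, Ψ ((n : ℝ)⁻¹ • planeVec z) *
      (1 - χ p ((n : ℝ)⁻¹ • planeVec z)) / (n:ℝ) ^ 2 * criticalTwoPoint 3 (Fin.cons 0 z)) / g| <
      η / 4 + η / 4 := by
    rw [abs_div, abs_of_pos hgpos, div_lt_iff₀ hgpos]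
    calc |∑ z ∈ layerBox R n, Ψ ((n : ℝ)⁻¹ • planeVec z) *
          (1 - χ p ((n : ℝ)⁻¹ • planeVec z)) / (n:ℝ) ^ 2 * criticalTwoPoint 3 (Fin.cons 0 z)|
        ≤ B / (n:ℝ) ^ 2 * (1 + C * (θ / 4) ^ p * (n:ℝ) ^ 2 * g) := hnear_bd
      _ = (B / ((n:ℝ) ^ 2 * g) + B * C * (θ / 4) ^ p) * g := by
          field_simp
      _ < (η / 4 + η / 4) * g := by
          apply mul_lt_mul_of_pos_right _ hgpos
          linarith
  -- split the sum into FAR (`Ψ χ_p`) and NEAR (`Ψ (1 - χ_p)`)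
  have hsplit : (∑ z ∈ layerBox R n, Ψ ((n : ℝ)⁻¹ • planeVec z) / (n:ℝ) ^ 2 *
        criticalTwoPoint 3 (Fin.cons 0 z)) / g =
      (∑ z ∈ layerBox R n, Ψ ((n : ℝ)⁻¹ • planeVec z) * χ p ((n : ℝ)⁻¹ • planeVec z) / (n:ℝ) ^ 2 *
        criticalTwoPoint 3 (Fin.cons 0 z)) / g +
      (∑ z ∈ layerBox R n, Ψ ((n : ℝ)⁻¹ • planeVec z) *
        (1 - χ p ((n : ℝ)⁻¹ • planeVec z)) / (n:ℝ) ^ 2 * criticalTwoPoint 3 (Fin.cons 0 z)) / g := by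
    rw [← add_div, ← Finset.sum_add_distrib]
    congr 1
    refine Finset.sum_congr rfl fun z _ => ?_
    ring
  have key : ∀ X Y I L : ℝ, dist X I < η / 4 → dist I L < η / 4 → |Y| < η / 4 + η / 4 →
      dist (X + Y) L < η := by
    intro X Y I L hX hI hY
    rw [Real.dist_eq] at hX hI ⊢
    calc |X + Y - L| = |(X - I) + (I - L) + Y| := by congr 1; ring
      _ ≤ |X - I| + |I - L| + |Y| := (abs_add_le _ _).trans (by gcongr; exact abs_add_le _ _)
      _ < η / 4 + η / 4 + (η / 4 + η / 4) := by linarith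
      _ = η := by ring
  rw [hsplit]
  exact key _ _ _ _ h1 hp2' h3

end Summit.CriticalPhenomena.Ising3DConformalLimit.Cruxes.GaussianLimitNotScreened.SingleLayerLinearRegression

end
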